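/- Fleet lead `ym-wcr-19456-p1`, route `WeakCouplingRates`, crux `ColdBoxTwoPointFloorW` (stmt-QuantumFields-19608). -/
import Summits.QuantumFields.YangMills.Theorems.WeakCouplingRatesColdBoxDirichletWick
import Summits.QuantumFields.YangMills.Theorems.WeakCouplingRatesColdBoxTwoPointFloorStubBoxGaussianWick

/-!
# Crux `ColdBoxTwoPointFloor(W)`: plaquette variances of the pinned lattice-Maxwell Gaussians are at most `1`
# (`Q ⪰ λ_pλ_pᵀ ⇒ λ_p·Q⁻¹λ_p ≤ 1`) — the Gaussian-side tail input of the one-scale comparison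

For any pinned lattice-Maxwell precision matrix `Q = Σ_q λ_qλ_qᵀ` (Chatterjee's `LatticeMaxwell.Qmat pin a n`) and a plaquette `p`
of the box, `sᵀQs ≥ (λ_p·s)²` (`sq_dotProduct_coeff_le_dotProduct_Qmat`), hence for positive definite `Q` the plaquette variance
`λ_p·Q⁻¹λ_p ≤ 1` (`dotProduct_coeff_inv_mulVec_coeff_le_one`: with `w = Q⁻¹λ_p`, `λ_p·w = wᵀQw ≥ (λ_p·w)²`).  Instances:
`integral_dirCirc_sq_le_one` (`E_D[s(p)²] ≤ 1` under the Dirichlet Gaussian D1' for every plaquette of the enlarged box — in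
particular every plaquette touching the cold box) and `integral_boxCirc_sq_le_one` (free box Gaussian D1).  With the Gaussian tail
/ Chebyshev per plaquette and a union bound over the `O(β^{4θ})` plaquettes this controls the mass of the large-circulation region on
the GAUSSIAN side of stub `stub_boxDirichletDomination`/`stub_boxGaussianDomination` (the Yang–Mills side is `boxState_largeField_rarity`).
Everything proved; no definition; standard axioms.
-/

set_option autoImplicit false

noncomputable section

open MeasureTheory Matrix Finset
open Literature.MathematicalPhysics.QuantumFieldTheory
open Literature.MathematicalPhysics.QuantumFieldTheory.LatticeMaxwell
open Literature.MathematicalPhysics.QuantumFieldTheory.AxialGauge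

namespace Summit.QuantumFields.YangMills.Theorems.WeakCouplingRates

section General

variable {d : ℕ} {pin : Literature.MathematicalPhysics.QuantumLattice.ZdEdge d → Prop} [DecidablePred pin]
  {a : Literature.Probability.LatticeModels.Site d} {n : ℕ}

/-- **A rank-one lower bound on the precision matrix**: for a plaquette `p` of the box, the form `sᵀQs = Σ_q s(q)²` dominates
`(λ_p · s)²`. -/
theorem sq_dotProduct_coeff_le_dotProduct_Qmat (p : Plaq d) (hp : p ∈ plaquettesIn (Literature.Probability.LatticeModels.halfOpenBox d n))
    (s : Free pin a n → ℝ) :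
    (coeff pin a n (Plaq.shift a p) ⬝ᵥ s) ^ 2 ≤ s ⬝ᵥ Qmat pin a n *ᵥ s := by
  rw [dotProduct_Qmat_mulVec, formM_zero_eq]
  exact Finset.single_le_sum (f := fun q => (coeff pin a n (Plaq.shift a q) ⬝ᵥ s) ^ 2) (fun q _ => sq_nonneg _) hp

/-- **Plaquette variances are at most one**: for positive definite `Q` and a plaquette `p` of the box,
`λ_p · Q⁻¹ λ_p ≤ 1` (since `Q ⪰ λ_p λ_pᵀ`: with `w = Q⁻¹λ_p`, `λ_p·w = wᵀQw ≥ (λ_p·w)²`). -/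
theorem dotProduct_coeff_inv_mulVec_coeff_le_one (hQ : (Qmat pin a n).PosDef) (p : Plaq d)
    (hp : p ∈ plaquettesIn (Literature.Probability.LatticeModels.halfOpenBox d n)) :
    coeff pin a n (Plaq.shift a p) ⬝ᵥ (Qmat pin a n)⁻¹ *ᵥ coeff pin a n (Plaq.shift a p) ≤ 1 := by
  classical
  set Q := Qmat pin a n with hQdef
  set lam := coeff pin a n (Plaq.shift a p) with hlam
  set w := Q⁻¹ *ᵥ lam with hw
  -- Q w = λ
  have hQw : Q *ᵥ w = lam := by
    rw [hw, mulVec_mulVec, mul_nonsing_inv _ ((isUnit_iff_isUnit_det Q).1 hQ.isUnit), one_mulVec]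
  -- a := λ·w = wᵀ Q w ≥ (λ·w)²
  have h1 : lam ⬝ᵥ w = w ⬝ᵥ Q *ᵥ w := by rw [hQw, dotProduct_comm]
  have h2 : (lam ⬝ᵥ w) ^ 2 ≤ w ⬝ᵥ Q *ᵥ w := sq_dotProduct_coeff_le_dotProduct_Qmat p hp w
  rw [← h1] at h2
  nlinarith

end General

/-! ## Instances: the free box Gaussian (D1) and the Dirichlet Gaussian (D1') have plaquette variances `≤ 1` -/

section Instances

variable {H : ℕ}

/-- **Dirichlet plaquette variances are at most one**: `E_D[s(p)²] ≤ 1` for every plaquette `p = (x − dirCorner) + dirCorner` of the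
enlarged box (in particular every plaquette touching the cold box) — the Gaussian-side tail input (Chebyshev / Gaussian tail per
plaquette, then a union bound over the `≤ 75000β^{4θ}` plaquettes) of the one-scale comparison. -/
theorem integral_dirCirc_sq_le_one (p : Plaq 4)
    (hp : p ∈ plaquettesIn (Literature.Probability.LatticeModels.halfOpenBox 4 (2 * H + 3))) :
    ∫ s, dirCirc H (Plaq.shift dirCorner p) s ^ 2 ∂(boxDirichlet H) ≤ 1 := by
  have h := integral_dirCirc_mul (H := H) (Plaq.shift dirCorner p) (Plaq.shift dirCorner p)
  simp_rw [← sq] at h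
  rw [h]
  exact dotProduct_coeff_inv_mulVec_coeff_le_one (posDef_dirQmat H) p hp

/-- **Free-box plaquette variances are at most one**: `E_τ[s(p)²] ≤ 1` under `boxMaxwell H` for every plaquette of the vertex box
`{0,…,2H}⁴`. -/
theorem integral_boxCirc_sq_le_one (p : Plaq 4)
    (hp : p ∈ plaquettesIn (Literature.Probability.LatticeModels.halfOpenBox 4 (2 * H + 1))) :
    ∫ s, boxCirc H p s ^ 2 ∂(boxMaxwell H) ≤ 1 := by
  have h := integral_boxCirc_mul_boxCirc (H := H) p p
  simp_rw [← sq] at h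
  rw [h]
  have := dotProduct_coeff_inv_mulVec_coeff_le_one (posDef_boxQmat H) p hp
  simpa using this

end Instances

end Summit.QuantumFields.YangMills.Theorems.WeakCouplingRates

end
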